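import Summits.CriticalPhenomena.PercolationContinuityZ3.Theorems.Transplant.PlanarSkeletonFrmThreads
import Summits.CriticalPhenomena.PercolationContinuityZ3.Theorems.Transplant.PlanarSkeletonFrmRays
import Summits.CriticalPhenomena.PercolationContinuityZ3.Theorems.Transplant.SubgraphLocModCycleB
import HarnessLib

/-!
# Φ2 at the interface level, IV: the CYCLE KIT of a small-cylinder edge in the big cylinder graph `G[C_{ℓ+3}(t)]` of a frames-only skeleton

builds on p205010 (kernel theorem, internal audit signed; external expert review pending) — nothing in this file uses p205010; nothing
here is a claim about the open node `SamePDropOfSkeletonFrm₁`.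
Lane `prim-bschramm`, seat `prim-bschramm-p4` gen 14 (PART C3 of `P4-GENERAL.md`, §36).  Helper file
(`--supports stmt-CriticalPhenomena-4575 --as helper`).  No probability.

For the graph–subgraph strict inequality `p_c(C_{ℓ+3}) < p_c(C_ℓ)` (file V; gen 10's `SubStrict.Setup`) every edge `{x, y}` of the big
cylinder graph `H = G[C_{ℓ+3}(t)]` with both ends in the small cylinder `Λ_ℓ` needs a `SubLoc.CycleKit`: a cycle `x —A→ p —M→ q —B→ y → x`
whose run `M` consists of ENHANCEMENT edges (an end outside `Λ_ℓ`), inside a ball of uniform radius.  **`exists_kit`** builds it from a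
column matching `C : ColData` (file I) WITHOUT any group structure: `A` = the up-thread of `x` to its apex (ceiling `φ₀ − φ₀ t = ℓ+2`),
`B` = the down-thread of `y` from the floor, the run = the (ι)-staircase around the square `‖·‖_∞ = ℓ+2` (file III) followed by a
fibre adjustment inside a unit cylinder whose length is bounded by file III's uniform bound `N`; the three meeting conditions by the
surgery lemma `SubLoc.exists_cycleKit_of_walks`.  Recorded with the kit: both columns stay in their APEX CLASSES (the column classes of
the exhaustion of file V) and the zone lies in `B_H(x, 10ℓ+21+N)`.
[cite: AizenmanGrimmett1991, Thm 1 (essential enhancements)] [cite: BalisterBollobasRiordan2014, §"bond percolation" p. 13]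
[cite: KozmaNitzan2024, §4 p. 15 (boxes and their translates)]
-/

noncomputable section

namespace Summit.CriticalPhenomena.PercolationContinuityZ3.Theorems.Transplant

namespace PlanarSkeletonFrm

open SimpleGraph Walk Literature.Probability.LatticeModels SubLoc
open Literature.Barriers.CriticalPhenomena (graphBall graphBall_finite)
open scoped Classical

variable {V : Type} {G : SimpleGraph V} [G.LocallyFinite] (Φ : PlanarSkeletonFrm G)

/-! ## §1 Bookkeeping: boxes with two coordinates, induced walks -/

omit [G.LocallyFinite] in
/-- Membership in a planar box, coordinate-wise. [folklore] -/
theorem mem_box_two {z : Site 2} {L : ℕ} : z ∈ box 2 L ↔ |z 0| ≤ L ∧ |z 1| ≤ L := by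
  rw [mem_box]
  constructor
  · intro h; exact ⟨abs_le.2 (h 0), abs_le.2 (h 1)⟩
  · rintro ⟨h0, h1⟩ i
    match i with
    | 0 => exact abs_le.1 h0
    | 1 => exact abs_le.1 h1

/-- Membership in a cylinder, coordinate-wise. [folklore] -/
theorem mem_cyl_two {t w : V} {L : ℕ} : w ∈ Φ.cyl t L ↔ |Φ.φ w 0 - Φ.φ t 0| ≤ L ∧ |Φ.φ w 1 - Φ.φ t 1| ≤ L := by
  rw [mem_cyl, mem_box_two]; rfl

/-- The slab lies in the big cylinder. [folklore] -/
theorem slab_subset_cyl (t : V) (ℓ : ℕ) : Φ.slab t ℓ ⊆ Φ.cyl t (ℓ + 3) := by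
  intro w hw
  rw [mem_cyl_two]; push_cast
  exact ⟨hw.1.trans (by linarith), hw.2⟩

omit [G.LocallyFinite] in
/-- Membership in the support of an induced walk. [folklore] -/
theorem mem_support_induce {s : Set V} {u v : V} (w : G.Walk u v) (hw : ∀ z ∈ w.support, z ∈ s) (z : s) :
    z ∈ (w.induce s hw).support ↔ z.1 ∈ w.support := by
  simp [Walk.support_induce]

omit [G.LocallyFinite] in
/-- The length of an induced walk. [folklore] -/
theorem length_induce_eq {s : Set V} {u v : V} (w : G.Walk u v) (hw : ∀ z ∈ w.support, z ∈ s) :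
    (w.induce s hw).length = w.length := by
  have h := Walk.length_map (Embedding.induce s).toHom (w.induce s hw)
  rw [Walk.map_induce] at h
  exact h.symm

omit [G.LocallyFinite] in
/-- An induced walk is a path iff the walk is. [folklore] -/
theorem isPath_induce_iff_isPath {s : Set V} {u v : V} (w : G.Walk u v) (hw : ∀ z ∈ w.support, z ∈ s) :
    (w.induce s hw).IsPath ↔ w.IsPath := by
  have h := Walk.isPath_map_iff_of_injective (f := (Embedding.induce s : G.induce s ↪g G).toHom) (p := w.induce s hw)
    (Embedding.induce s : G.induce s ↪g G).injective
  rw [Walk.map_induce] at h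
  exact h.symm

/-! ## §2 The subgraph class and the enhancement class of the pair `C_ℓ(t) ⊆ C_{ℓ+3}(t)` -/

/-- **The subgraph class**: edges of the big cylinder graph `G[C_{ℓ+3}(t)]` with both ends in the small cylinder `Λ_ℓ`. [folklore] -/
def EH (t : V) (ℓ : ℕ) : Set (Sym2 (Φ.cyl t (ℓ + 3))) :=
  {d | d ∈ (G.induce (Φ.cyl t (ℓ + 3))).edgeSet ∧ ∀ z ∈ d, Φ.φ z.1 - Φ.φ t ∈ box 2 ℓ}

/-- **The enhancement class**: edges of the big cylinder graph with an end outside `Λ_ℓ`. [folklore] -/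
def Eenh (t : V) (ℓ : ℕ) : Set (Sym2 (Φ.cyl t (ℓ + 3))) :=
  {d | d ∈ (G.induce (Φ.cyl t (ℓ + 3))).edgeSet ∧ ¬ ∀ z ∈ d, Φ.φ z.1 - Φ.φ t ∈ box 2 ℓ}

/-! ## §3 The cycle kit of a subgraph edge -/

/-- **THE CYCLE KIT of a small-cylinder edge `{x, y}`** (orientation: the `φ₁`'s differ or `y` is not above `x`): columns = up-thread of `x` /
down-thread of `y` inside their apex classes, run = staircase + fibre adjustment outside `Λ_ℓ`, zone in `B_H(x, 10ℓ+21+N)` where `N` is the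
uniform fibre-adjustment bound at distance `10ℓ+21`. [cite: AizenmanGrimmett1991, Thm 1 (essential enhancements)]
[cite: BalisterBollobasRiordan2014, §"bond percolation" p. 13] -/
theorem exists_kit {t : V} {ℓ : ℕ} (C : Φ.ColData t ℓ) {N : ℕ}
    (hN : ∀ w w' : V, Φ.φ w' = Φ.φ w → w' ∈ graphBall G w (10 * ℓ + 21) →
      ∃ W : G.Walk w w', W.length ≤ N ∧ ∀ z ∈ W.support, Φ.φ z - Φ.φ w ∈ box 2 1)
    (x y : Φ.cyl t (ℓ + 3)) (hxy : s(x, y) ∈ Φ.EH t ℓ) (hor : Φ.φ x.1 1 ≠ Φ.φ y.1 1 ∨ Φ.φ y.1 0 ≤ Φ.φ x.1 0) :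
    ∃ K : CycleKit (G.induce (Φ.cyl t (ℓ + 3))) (Φ.Eenh t ℓ) x y,
      (∀ w ∈ K.A.support, C.apex w.1 = C.apex x.1) ∧ (∀ w ∈ K.B.support, C.apex w.1 = C.apex y.1) ∧
      K.Z ⊆ graphBall (G.induce (Φ.cyl t (ℓ + 3))) x (10 * ℓ + 21 + N) := by
  -- the edge and its ends
  have hadj : (G.induce (Φ.cyl t (ℓ + 3))).Adj x y := hxy.1
  have hGadj : G.Adj x.1 y.1 := hadj
  have hxb : Φ.φ x.1 - Φ.φ t ∈ box 2 ℓ := hxy.2 x (Sym2.mem_mk_left _ _)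
  have hyb : Φ.φ y.1 - Φ.φ t ∈ box 2 ℓ := hxy.2 y (Sym2.mem_mk_right _ _)
  have hx := mem_box_two.1 hxb
  have hy := mem_box_two.1 hyb
  simp only [Pi.sub_apply] at hx hy
  have hx0 := hx.1; have hx1 := hx.2; have hy0 := hy.1; have hy1 := hy.2
  rw [abs_le] at hx0 hx1 hy0 hy1
  have hxs : x.1 ∈ Φ.slab t ℓ := ⟨abs_le.2 ⟨by omega, by omega⟩, abs_le.2 ⟨by omega, by omega⟩⟩
  have hys : y.1 ∈ Φ.slab t ℓ := ⟨abs_le.2 ⟨by omega, by omega⟩, abs_le.2 ⟨by omega, by omega⟩⟩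
  -- the columns in `G`
  obtain ⟨WA, hAP, hAlen, hAsup⟩ := C.exists_upWalk hxs
  obtain ⟨b, WB, hb0, hBP, hBlen, hBsup⟩ := C.exists_downWalk hys
  have hb1 : Φ.φ b 1 = Φ.φ y.1 1 := (hBsup b WB.end_mem_support).2.2.1
  -- the staircase from the apex of `x` to the position of `b`
  have hap0 := C.φ0_apex hxs
  have hap1 := C.φ1_apex hxs
  obtain ⟨q', WS, hq0, hq1, hSlen, hSsup⟩ := Φ.exists_stair t (C.apex x.1) ℓ (Φ.φ b 1 - Φ.φ t 1) hap0
    (by rw [hap1]; exact abs_le.2 ⟨by omega, by omega⟩) (by rw [hb1]; exact abs_le.2 ⟨by omega, by omega⟩)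
  -- the fibre adjustment from `q'` to `b`
  have hφq : Φ.φ b = Φ.φ q' := by
    ext i
    match i with
    | 0 => omega
    | 1 => omega
  have hball : b ∈ graphBall G q' (10 * ℓ + 21) := by
    refine ⟨(WS.reverse.append WA.reverse).append (Walk.cons hGadj WB), ?_⟩
    rw [Walk.length_append, Walk.length_append, Walk.length_reverse, Walk.length_reverse, Walk.length_cons]
    omega
  obtain ⟨WJ, hJlen, hJsup⟩ := hN q' b hφq hball
  -- membership in the big cylinder / outside the small one
  have hAmem : ∀ z ∈ WA.support, z ∈ Φ.cyl t (ℓ + 3) := fun z hz => Φ.slab_subset_cyl t ℓ (hAsup z hz).1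
  have hBmem : ∀ z ∈ WB.support, z ∈ Φ.cyl t (ℓ + 3) := fun z hz => Φ.slab_subset_cyl t ℓ (hBsup z hz).1
  have hMmem : ∀ z ∈ (WS.append WJ).support, z ∈ Φ.cyl t (ℓ + 3) ∧ Φ.φ z - Φ.φ t ∉ box 2 ℓ := by
    intro z hz
    rw [Walk.mem_support_append_iff] at hz
    rcases hz with hz | hz
    · obtain ⟨⟨h0, h1⟩, hout⟩ := hSsup z hz
      refine ⟨Φ.mem_cyl_two.2 ⟨h0.trans (by push_cast; omega), h1.trans (by push_cast; omega)⟩, fun hin => ?_⟩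
      obtain ⟨hin0, hin1⟩ := mem_box_two.1 hin
      simp only [Pi.sub_apply] at hin0 hin1
      rcases hout with hout | hout <;> omega
    · have hz1 := mem_box_two.1 (hJsup z hz)
      simp only [Pi.sub_apply] at hz1
      obtain ⟨hz0, hz1⟩ := hz1
      rw [abs_le] at hz0 hz1
      refine ⟨Φ.mem_cyl_two.2 ⟨abs_le.2 ⟨by push_cast; omega, by push_cast; omega⟩,
        abs_le.2 ⟨by push_cast; omega, by push_cast; omega⟩⟩, fun hin => ?_⟩
      obtain ⟨hin0, -⟩ := mem_box_two.1 hin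
      simp only [Pi.sub_apply] at hin0
      rw [abs_le] at hin0
      omega
  -- the three walks in `H`
  set A : (G.induce (Φ.cyl t (ℓ + 3))).Walk x ⟨C.apex x.1, hAmem _ WA.end_mem_support⟩ :=
    WA.induce (Φ.cyl t (ℓ + 3)) hAmem with hAdef
  set Bi : (G.induce (Φ.cyl t (ℓ + 3))).Walk y ⟨b, hBmem _ WB.end_mem_support⟩ :=
    WB.induce (Φ.cyl t (ℓ + 3)) hBmem with hBidef
  set M₀ : (G.induce (Φ.cyl t (ℓ + 3))).Walk ⟨C.apex x.1, hAmem _ WA.end_mem_support⟩ ⟨b, hBmem _ WB.end_mem_support⟩ :=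
    (WS.append WJ).induce (Φ.cyl t (ℓ + 3)) (fun z hz => (hMmem z hz).1) with hM₀def
  have hA : A.IsPath := (isPath_induce_iff_isPath _ _).2 hAP
  have hB : Bi.reverse.IsPath := ((isPath_induce_iff_isPath _ _).2 hBP).reverse
  have hmemA : ∀ w, w ∈ A.support → w.1 ∈ WA.support := fun w hw => (mem_support_induce _ _ w).1 hw
  have hmemB : ∀ w, w ∈ Bi.reverse.support → w.1 ∈ WB.support := fun w hw =>
    (mem_support_induce _ _ w).1 (by rwa [Walk.support_reverse, List.mem_reverse] at hw)
  have hmemM : ∀ w, w ∈ M₀.support → w.1 ∈ (WS.append WJ).support := fun w hw => (mem_support_induce _ _ w).1 hw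
  have hAB : ∀ w, w ∈ A.support → w ∈ Bi.reverse.support → False := by
    intro w hwA hwB
    obtain ⟨-, -, hA1, hA0, hAx⟩ := hAsup w.1 (hmemA w hwA)
    obtain ⟨-, -, hB1, hB0, hBy⟩ := hBsup w.1 (hmemB w hwB)
    rcases hor with hor | hor
    · exact hor (hA1.symm.trans hB1)
    · have e1 : w.1 = x.1 := hAx (by omega)
      have e2 : w.1 = y.1 := hBy (by omega)
      exact hadj.ne (Subtype.ext (e1.symm.trans e2))
  set P : Φ.cyl t (ℓ + 3) → Prop := fun z => Φ.φ z.1 - Φ.φ t ∉ box 2 ℓ with hP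
  have hM₀P : ∀ w ∈ M₀.support, P w := fun w hw => (hMmem w.1 (hmemM w hw)).2
  have hE : ∀ ⦃u v : Φ.cyl t (ℓ + 3)⦄, (G.induce (Φ.cyl t (ℓ + 3))).Adj u v → P u → P v → s(u, v) ∈ Φ.Eenh t ℓ :=
    fun u v huv hu _ => ⟨huv, fun hall => hu (hall u (Sym2.mem_mk_left _ _))⟩
  obtain ⟨K, hKA, hKB, hKM⟩ := SubLoc.exists_cycleKit_of_walks A Bi.reverse M₀ hA hB hAB P hM₀P
    (fun h => h hxb) (fun h => h hyb) hE hadj.symm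
  refine ⟨K, fun w hw => (hAsup w.1 (hmemA w (hKA w hw))).2.1, fun w hw => (hBsup w.1 (hmemB w (hKB w hw))).2.1, ?_⟩
  -- the zone radius
  have hAl : A.length ≤ 2 * ℓ + 4 := by rw [hAdef, length_induce_eq]; exact hAlen
  have hBl : Bi.length ≤ 2 * ℓ + 4 := by rw [hBidef, length_induce_eq]; exact hBlen
  have hMl : M₀.length ≤ 6 * ℓ + 12 + N := by
    rw [hM₀def, length_induce_eq, Walk.length_append]; omega
  intro w hw
  rcases K.Z_subset_of_supports hKA hKB hKM hw with hw | hw | hw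
  · exact ⟨A.takeUntil w hw, (A.length_takeUntil_le_length hw).trans (by omega)⟩
  · have hw' : w ∈ (A.append M₀).support := by rw [Walk.mem_support_append_iff]; exact Or.inr hw
    refine ⟨(A.append M₀).takeUntil w hw', ((A.append M₀).length_takeUntil_le_length hw').trans ?_⟩
    rw [Walk.length_append]; omega
  · have hw' : w ∈ (Walk.cons hadj Bi).support := by
      rw [Walk.support_cons, List.mem_cons]
      rw [Walk.support_reverse, List.mem_reverse] at hw
      exact Or.inr hw
    refine ⟨(Walk.cons hadj Bi).takeUntil w hw', ((Walk.cons hadj Bi).length_takeUntil_le_length hw').trans ?_⟩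
    rw [Walk.length_cons]; omega

end PlanarSkeletonFrm

end Summit.CriticalPhenomena.PercolationContinuityZ3.Theorems.Transplant

end
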